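import Summits.QuantumFields.BalabanUV.Beta.FP.TowerNSlotLetters

/-!
# `BalabanUV.Beta.FP.TowerNestedColumnTreeGauge` — road «FP», binder row D1, ROUTE T (β1), Q-FP-46-1 STEP (i) (`g46/SPEC-58.md` §6): **THE END WRAPPER's NESTED
# COLUMN IS TREE-GAUGE-FIXED AT EVERY STOREY BELOW THE TOP** — for v5∕v6's pin `hhv : hv v = I *ᵥ Sum.elim (ψ v) 0`, `I = minOp H₀ (fromRows Q₁₀ τ₁)`, and the
# one-shot right inverse `hXF : kkt H₀ (fromRows Q₁₀ τ₁) * XF = 1`: **`τ₁ *ᵥ hv v = 0`** (the `τ₁` rows of the constraint value are fed `0`; lit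
# `CompositionSingular.mul_minOp`)

WHY (journal [D1P3-G46-A5] as CORRECTED by [D1P3-G46-CORR-2], an2 [AN2-G70-A4]).  Engine C's K2L TIER V locates the depth-2 defect of the displayed rows
(K2b)∕(J-Λ₂′) in the storeywise term `Rcomp_λ`, which vanishes for gauge functions constant on the sub-top blocks.  The road's read-out `λ_a = lv (e_a)` is, by
g39 `TorusWJunctionOfNLeg.hv_single_apply_eq_of_NLeg_sym` and `TorusCompositeUnimodular.bigP_mul_towerGen_eq`, MINUS THE INTEGRAL OF THE NESTED COLUMN `hv` ALONG
THE ONE-SHOT BIG COMB (`bigP … (n+1)` is the big comb's rows, `P·W₀ = U·towerEvalC` with `U` its reduced incidence matrix).  THIS FILE's `τ₁ *ᵥ hv v = 0` kills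
every big-comb bond INSIDE a sub-top block (those lie on the sub-top trees: `TorusCombForest.axisOf` is the lowest deviating axis and the big root is congruent to
the sub-top roots), so `λ_a(x)` reduces to the sum of `hv` over the sub-top FACE CROSSINGS on the big-comb path to `x`.  Whether that sum is constant on the
sub-top blocks is EQUIVALENT to `hv` taking one value across each sub-top face met by the comb (transverse in-block offsets) — a property of the minimiser of
`H₀` under `Q₁₀ h = ψ, τ₁ h = 0` for which the road has NO structural argument (CORR-2 withdraws A-5's step (iii); by-value check (a′) asked of Engine C).
Generic statement, no tower objects: any `H₀ Q₁₀ τ₁ XF I ψ`.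
WHAT ([folklore] `Matrix` bookkeeping; no `def`, no `def … : Prop`, nothing cited, 0 sorry): `toRows₂_one_mulVec_sum_elim`, **`constraintRows₂_mulVec_minOp_col_eq_zero`**,
**`tau1_mulVec_hv_eq_zero`** (v5∕v6's letters `hhv hI hXF` VERBATIM in shape, per storey and box).
WHAT THIS IS NOT: not a block-constancy statement about `lv` (open, CORR-2); nothing of Bałaban's asserted, valued or discharged; 0 estimates; 0∕4 row-D1
binders (hW, hR, D1Tel, D1Rep);
ROOT M‴ p325680 ∕ P5c ∕ D6 untouched; NOT (C1), NOT (T-ID), NOT D1, NEVER «G-an2-4 closed», NOT BetaPertH, NOT continuum, NOT Clay.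

HONEST DEPENDENCY (page 1, mandatory): continuum YM on T⁴ ⇐ BetaPertH ∧ nine spine estimates (0/9 proved); BetaPertH ⇐ (D1) ∧ (D4) ∧ CAP+tail;
G-an2-4 gates asym, D1 and NE2/3/4.  HONEST FRAMING (cell contract, verbatim): «discharging `BetaPertH` makes Bałaban's UV stability UNCONDITIONAL —
a real constructive-QFT result; it is NOT the continuum limit and NOT the Clay problem.»  ABSOLUTE RULE (cell charter, verbatim): «No internally-minted
statement may enter as a cited fact. Every hypothesis is either kernel-proved in this package or a verbatim quotation of a PUBLISHED theorem with page
reference. The manuscript(s) under audit are NOT citable for their own disputed steps — they are the thing under adjudication; programme-internal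
(2001/route/tribunal) claims are never citable.»  Road «FP» OWNER, b2b-balaban-beta-d1-p3 gen 46, 2026-08-28.  No existing file touched.
-/

noncomputable section

namespace Summit.QuantumFields.BalabanUV.Beta.FP.TowerNestedColumnTreeGauge

open Matrix
open Literature.MathematicalPhysics.QuantumFieldTheory.Balaban1983to89.Beta.Composition (kkt)
open Literature.MathematicalPhysics.QuantumFieldTheory.Balaban1983to89.Beta.CompositionSingular (minOp mul_minOp)

section Generic

variable {ι₀ ι₁ ι₂ : Type*} [Fintype ι₀] [Fintype ι₁] [Fintype ι₂] [DecidableEq ι₀] [DecidableEq ι₁] [DecidableEq ι₂]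

/-- [folklore] the lower rows of the identity applied to a vector supported on the upper block vanish. -/
theorem toRows₂_one_mulVec_sum_elim (ψ : ι₁ → ℝ) :
    (Matrix.toRows₂ (1 : Matrix (ι₁ ⊕ ι₂) (ι₁ ⊕ ι₂) ℝ)) *ᵥ Sum.elim ψ (0 : ι₂ → ℝ) = 0 := by
  funext i
  simp only [Matrix.mulVec, dotProduct, Matrix.toRows₂_apply, Fintype.sum_sum_type, Sum.elim_inl, Sum.elim_inr, Pi.zero_apply, mul_zero,
    Finset.sum_const_zero, add_zero, Matrix.one_apply, Sum.inr.injEq, reduceCtorEq, if_false, zero_mul]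

/-- [folklore] **`constraintRows₂_mulVec_minOp_col_eq_zero`** — for an invertible KKT system with stacked constraints `[Q; τ]`, the minimiser fed the constraint value
`(ψ, 0)` satisfies the lower constraints exactly: `τ *ᵥ (minOp H [Q; τ] *ᵥ (ψ, 0)) = 0` (lit `mul_minOp`: `[Q; τ] * minOp = 1`). -/
theorem constraintRows₂_mulVec_minOp_col_eq_zero (H : Matrix ι₀ ι₀ ℝ) (Q : Matrix ι₁ ι₀ ℝ) (τ : Matrix ι₂ ι₀ ℝ)
    (X : Matrix (ι₀ ⊕ (ι₁ ⊕ ι₂)) (ι₀ ⊕ (ι₁ ⊕ ι₂)) ℝ) (hX : kkt H (Matrix.fromRows Q τ) * X = 1)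
    {I : Matrix ι₀ (ι₁ ⊕ ι₂) ℝ} (hI : minOp H (Matrix.fromRows Q τ) = I) (ψ : ι₁ → ℝ) :
    τ *ᵥ (I *ᵥ Sum.elim ψ (0 : ι₂ → ℝ)) = 0 := by
  have hdet : IsUnit (kkt H (Matrix.fromRows Q τ)).det := Matrix.isUnit_det_of_right_inverse hX
  have h1 : Matrix.fromRows Q τ * I = 1 := by rw [← hI]; exact mul_minOp H (Matrix.fromRows Q τ) hdet
  have h2 : τ * I = Matrix.toRows₂ (1 : Matrix (ι₁ ⊕ ι₂) (ι₁ ⊕ ι₂) ℝ) := by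
    rw [← h1, Matrix.fromRows_mul, Matrix.toRows₂_fromRows]
  rw [Matrix.mulVec_mulVec, h2, toRows₂_one_mulVec_sum_elim]

/-- [folklore] **`tau1_mulVec_hv_eq_zero` — v5∕v6's NESTED COLUMN IS TREE-GAUGE-FIXED BELOW THE TOP** (their letters `hhv hI hXF` per storey and box, the next-level
column `ψ v` abstract): `τ₁ *ᵥ hv v = 0` for every source vector `v`. -/
theorem tau1_mulVec_hv_eq_zero {κ : Type*} (H₀ : Matrix ι₀ ι₀ ℝ) (Q₁₀ : Matrix ι₁ ι₀ ℝ) (τ₁ : Matrix ι₂ ι₀ ℝ)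
    (XF : Matrix (ι₀ ⊕ (ι₁ ⊕ ι₂)) (ι₀ ⊕ (ι₁ ⊕ ι₂)) ℝ) (hXF : kkt H₀ (Matrix.fromRows Q₁₀ τ₁) * XF = 1)
    {I : Matrix ι₀ (ι₁ ⊕ ι₂) ℝ} (hI : minOp H₀ (Matrix.fromRows Q₁₀ τ₁) = I) (ψ : (κ → ℝ) → (ι₁ → ℝ))
    {hv : (κ → ℝ) → (ι₀ → ℝ)} (hhv : ∀ v, hv v = I *ᵥ Sum.elim (ψ v) 0) (v : κ → ℝ) :
    τ₁ *ᵥ hv v = 0 := by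
  rw [hhv]
  exact constraintRows₂_mulVec_minOp_col_eq_zero H₀ Q₁₀ τ₁ XF hXF hI (ψ v)

end Generic

end Summit.QuantumFields.BalabanUV.Beta.FP.TowerNestedColumnTreeGauge

end
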